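import Summits.Ventures.YMGap.BEDoor.QuasiLocal

/-!
# BEDoor / Approx — §4d S-POISSON dissolved: the quasi-local door for SMOOTH C²-approximable S
# (module 05/11 of the Bakry–Émery door, LIFT edition v8.3 = parts `Approx` (v8.2 module 07); cell `ym-beyond`, seat P4)

HONEST FRAMING (cell `ym-beyond`, seat P4 «Hessian-currency receiver», lens Y2; HUMAN RULINGS D-0035 / D-0037; memo `HOME/ROUTE-P4Y2.md` v8.1 +
g10 addendum, spec `HOME/ROUTE-P4Y2-LIFT-SPEC-v83.md`; LIFT edition v8.3 = the v8.2 module bodies of `HOME/ROUTE-P4Y2-Sketch.lean` v8.1, byte-identical and in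
order, re-packed into 11 ≤ 400-line modules (fewer olean round-trips; director-ym line №2 (B)); the g10 appendix `OpenStrip` is a separate, UNQUEUED HOME file (line №3 (D))).  FINITE-LATTICE
statements at STRONG effective coupling: a RECEIVER («door») in HESSIAN (Bakry–Émery) currency for renormalisation-group output, typed over the
tree's generic clustering chain `Thresholds/SharpClustering*` + `Thresholds/LatticeBakryEmery*`, complementary to the Dobrushin-currency door
`YM4Door/*` (LITERALLY the same INPUT predicate `QuasiLocalGaugePerturbation.HasAnalyticNormLE … stripDomain`, the same OUTPUT predicate
`RobustBall.ClustersWith`; no residual hypothesis: Osgood regularity is the tree's `Literature.Analysis.Complex.SCV.contDiffOn_infty`,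
part `Osgood` of module `AnalyticStrip`).  Nothing here is a statement about `β → ∞`, the continuum limit or the Clay problem; NO effective action is asserted to be at
the door (that INPUT is not in print for `d = 4`); the verdict «the two windows do not meet» is unchanged in this currency.
WHAT THIS IS NOT (ladder rung R2d; director-ym line №2 (B)): every door of this LIFT is an entry on the STRONG-COUPLING BANK of THE NUMBER —
finite-lattice exponential clustering at SMALL `|β|` and small strip norm `η` of the perturbation (`SU(2)`, `d = 4`: `16.2|β| + 4.4η < 1`, module `SU2`,
conclusion literally `RobustBall.ClustersWith`) — NOT clustering at weak coupling, NOT a statement at large `β`, NOT the mass gap.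
No conjecture name, no `sorry`, no axiom beyond the standard three; every theorem is bookkeeping over the tree. [folklore]
References: H. Shen, R. Zhu, X. Zhu, CMP 400 (2023) 805 (arXiv:2204.12737) Thm 1.2, Cor. 4.4/4.11; D. Bakry, M. Émery, LNM 1123 (1985);
T. Bałaban, CMP 109 (1987) 249, (1.18)–(1.22) (analyticity format); L. Hörmander, An Introduction to Complex Analysis in Several Variables
(1973) Thm 2.2.1/2.2.6 (Osgood); E. J. McShane, Bull. AMS 40 (1934) 837 (Lipschitz extension).

THIS MODULE, part `Approx` (§4d S-POISSON dissolved: the quasi-local door for SMOOTH C²-approximable S): `C2PolyApprox S` (sup, `HessBound`,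
`OffDiagHessBound` of `p − S` all `≤ ε`, every `ε > 0`), `abs_integral_exp_sub_le`, `cov_squeeze_alg`, ★★ `cov_decay_quasilocal_of_approx` (the
`QuasiLocal.lean` bound with the SAME constants), torus `beDoorQL_abs_le_of_approx` / `beDoorQL_gibbsCov_le_of_approx`.
-/

noncomputable section

open scoped Matrix ComplexConjugate BigOperators Matrix.Norms.Frobenius ContDiff Topology
open Matrix Complex Finset MeasureTheory Filter
open Literature.MathematicalPhysics.QuantumFieldTheory
open Literature.MathematicalPhysics.QuantumFieldTheory.SUNBakryEmery (SUN FrameIdx frame)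

namespace Summit.Ventures.YMGap.BEDoor

open Summit.Ventures.YMGap Summit.Ventures.YMGap.LatticeBakryEmery Summit.Ventures.YMGap.SharpClustering
open Summit.Ventures.YMGap.HessianSharp

universe u

/-! ## §4d S-POISSON BY APPROXIMATION (PROVED modulo C²-Weierstrass): the quasi-local bound for a SMOOTH `S` that is
C²-approximable by polynomials in the tree's own currency — same constants.  This REDUCES the gap S-POISSON (Poisson
solvability for non-polynomial `S`) to `C2PolyApprox S` = polynomial density in C² on the compact group, pure classical
analysis with no gauge / Hodge content. -/

section Approx

variable {ι : Type u} [Fintype ι] [DecidableEq ι] {N : ℕ}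

/-- **D1 — C²-approximability by polynomials, in the tree's currency** (the hypothesis replacing S-POISSON): for every
`ε > 0` a polynomial `p` with `|p − S| ≤ ε` on `SU(N)^ι`, `HessBound (p − S) ε` and `OffDiagHessBound (p − S) ε`.  For smooth
(a fortiori real-analytic) `S` this is C²-Weierstrass on a compact subset of a Euclidean space — classical, NOT in the tree or
Mathlib as such; PROVED for every smooth `S` in §4e below (`c2PolyApprox_of_contDiff`, v6) by group convolution with polynomial
approximate identities. [folklore] -/
@[folklore]
def C2PolyApprox (S : Cfg ι N → ℝ) : Prop :=
  ∀ ε : ℝ, 0 < ε → ∃ (dS : ℕ) (p : Cfg ι N → ℝ), p ∈ polySpace ι N dS ∧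
    (∀ x : PSU ι N, |p (emb x) - S (emb x)| ≤ ε) ∧ HessBound (p - S) ε ∧ OffDiagHessBound (p - S) (fun _ _ => ε)

omit [DecidableEq ι] in
/-- `|∫ e^S F| ≤ ∫ e^S |F|`. [folklore] -/
theorem abs_integral_exp_mul_le_integral_abs (S : Cfg ι N → ℝ) (F : PSU ι N → ℝ) :
    |∫ x, Real.exp (S (emb x)) * F x ∂(haarPi ι N)| ≤ ∫ x, Real.exp (S (emb x)) * |F x| ∂(haarPi ι N) := by
  refine abs_integral_le_integral_abs.trans (le_of_eq (integral_congr_ae (ae_of_all _ fun x => ?_)))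
  simp only [abs_mul, abs_of_pos (Real.exp_pos _)]

omit [DecidableEq ι] in
/-- Comparison of tilted integrals: `|p − S| ≤ ε` on the group ⇒ `|∫ e^p F − ∫ e^S F| ≤ (e^ε − 1) ∫ e^S |F|`. [folklore] -/
theorem abs_integral_exp_sub_le {S p : Cfg ι N → ℝ} (hS : ContDiff ℝ ∞ S) (hp : ContDiff ℝ ∞ p) {ε : ℝ}
    (hε : ∀ x : PSU ι N, |p (emb x) - S (emb x)| ≤ ε) {F : PSU ι N → ℝ} (hF : Continuous F) :
    |(∫ x, Real.exp (p (emb x)) * F x ∂(haarPi ι N)) - ∫ x, Real.exp (S (emb x)) * F x ∂(haarPi ι N)| ≤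
      (Real.exp ε - 1) * ∫ x, Real.exp (S (emb x)) * |F x| ∂(haarPi ι N) := by
  have hSc : Continuous fun x : PSU ι N => S (emb x) := continuous_restrict hS
  have hpc : Continuous fun x : PSU ι N => p (emb x) := continuous_restrict hp
  have i1 : Integrable (fun x => Real.exp (p (emb x)) * F x) (haarPi ι N) :=
    integrable_of_continuous_PSU ((Real.continuous_exp.comp hpc).mul hF) _
  have i2 : Integrable (fun x => Real.exp (S (emb x)) * F x) (haarPi ι N) :=
    integrable_of_continuous_PSU ((Real.continuous_exp.comp hSc).mul hF) _
  have i3 : Integrable (fun x => Real.exp (S (emb x)) * |F x|) (haarPi ι N) :=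
    integrable_of_continuous_PSU ((Real.continuous_exp.comp hSc).mul hF.abs) _
  have hpt : ∀ x : PSU ι N, |Real.exp (p (emb x)) * F x - Real.exp (S (emb x)) * F x| ≤
      (Real.exp ε - 1) * (Real.exp (S (emb x)) * |F x|) := by
    intro x
    have h1 : Real.exp (p (emb x)) = Real.exp (S (emb x)) * Real.exp (p (emb x) - S (emb x)) := by
      rw [← Real.exp_add]; congr 1; ring
    rw [h1, show Real.exp (S (emb x)) * Real.exp (p (emb x) - S (emb x)) * F x - Real.exp (S (emb x)) * F x =
      Real.exp (S (emb x)) * ((Real.exp (p (emb x) - S (emb x)) - 1) * F x) by ring, abs_mul,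
      abs_of_pos (Real.exp_pos _), abs_mul]
    have h2 : |Real.exp (p (emb x) - S (emb x)) - 1| ≤ Real.exp ε - 1 :=
      (Literature.Geometry.Lorentzian.Deformation.abs_exp_sub_one_le_exp_abs_sub_one _).trans (by linarith [Real.exp_le_exp.2 (hε x)])
    calc Real.exp (S (emb x)) * (|Real.exp (p (emb x) - S (emb x)) - 1| * |F x|)
        ≤ Real.exp (S (emb x)) * ((Real.exp ε - 1) * |F x|) :=
          mul_le_mul_of_nonneg_left (mul_le_mul_of_nonneg_right h2 (abs_nonneg _)) (Real.exp_pos _).le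
      _ = (Real.exp ε - 1) * (Real.exp (S (emb x)) * |F x|) := by ring
  rw [← integral_sub i1 i2]
  calc |∫ x, (Real.exp (p (emb x)) * F x - Real.exp (S (emb x)) * F x) ∂(haarPi ι N)|
      ≤ ∫ x, |Real.exp (p (emb x)) * F x - Real.exp (S (emb x)) * F x| ∂(haarPi ι N) := abs_integral_le_integral_abs
    _ ≤ ∫ x, (Real.exp ε - 1) * (Real.exp (S (emb x)) * |F x|) ∂(haarPi ι N) :=
        integral_mono (i1.sub i2).abs (i3.const_mul _) hpt
    _ = (Real.exp ε - 1) * ∫ x, Real.exp (S (emb x)) * |F x| ∂(haarPi ι N) := integral_const_mul _ _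

omit [Fintype ι] [DecidableEq ι] in
/-- The real-number squeeze behind the approximation step. [folklore] -/
theorem cov_squeeze_alg {Z Iuv Iu Iv Z' Iuv' Iu' Iv' Juv Ju Jv a E Kp : ℝ} (hZ : 0 ≤ Z) (ha : 0 ≤ a) (hE : 0 ≤ E)
    (hKp : 0 < Kp) (hJuv : |Iuv| ≤ Juv) (hJu : |Iu| ≤ Ju) (hJv : |Iv| ≤ Jv)
    (dZ : |Z' - Z| ≤ a * Z) (dIuv : |Iuv' - Iuv| ≤ a * Juv) (dIu : |Iu' - Iu| ≤ a * Ju) (dIv : |Iv' - Iv| ≤ a * Jv)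
    (hZ'0 : 0 ≤ Z') (hb : |Z' * Iuv' - Iu' * Iv'| ≤ Z' ^ 2 * E / Kp) :
    |Z * Iuv - Iu * Iv| ≤ a * (2 + a) * (Z * Juv + Ju * Jv) + (Z * (1 + a)) ^ 2 * E / Kp := by
  have hJuv0 : 0 ≤ Juv := (abs_nonneg _).trans hJuv
  have hJu0 : 0 ≤ Ju := (abs_nonneg _).trans hJu
  have hJv0 : 0 ≤ Jv := (abs_nonneg _).trans hJv
  have hIuv' : |Iuv'| ≤ (1 + a) * Juv := by
    have := abs_add_le (Iuv' - Iuv) Iuv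
    rw [sub_add_cancel] at this
    nlinarith
  have hIv' : |Iv'| ≤ (1 + a) * Jv := by
    have := abs_add_le (Iv' - Iv) Iv
    rw [sub_add_cancel] at this
    nlinarith
  have hZ' : Z' ≤ Z * (1 + a) := by
    have := (abs_le.1 dZ).2
    nlinarith
  -- `|Cov − Cov'| ≤ a(2+a)G`
  have hdiff : |(Z * Iuv - Iu * Iv) - (Z' * Iuv' - Iu' * Iv')| ≤ a * (2 + a) * (Z * Juv + Ju * Jv) := by
    have hid : (Z * Iuv - Iu * Iv) - (Z' * Iuv' - Iu' * Iv') =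
        -((Z' - Z) * Iuv') - Z * (Iuv' - Iuv) + (Iu' - Iu) * Iv' + Iu * (Iv' - Iv) := by ring
    rw [hid]
    have t1 : |(Z' - Z) * Iuv'| ≤ (a * Z) * ((1 + a) * Juv) := by
      rw [abs_mul]; exact mul_le_mul dZ hIuv' (abs_nonneg _) (mul_nonneg ha hZ)
    have t2 : |Z * (Iuv' - Iuv)| ≤ Z * (a * Juv) := by
      rw [abs_mul, abs_of_nonneg hZ]; exact mul_le_mul_of_nonneg_left dIuv hZ
    have t3 : |(Iu' - Iu) * Iv'| ≤ (a * Ju) * ((1 + a) * Jv) := by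
      rw [abs_mul]; exact mul_le_mul dIu hIv' (abs_nonneg _) (mul_nonneg ha hJu0)
    have t4 : |Iu * (Iv' - Iv)| ≤ Ju * (a * Jv) := by
      rw [abs_mul]; exact mul_le_mul hJu dIv (abs_nonneg _) hJu0
    have s1 := abs_add_le (-((Z' - Z) * Iuv') - Z * (Iuv' - Iuv) + (Iu' - Iu) * Iv') (Iu * (Iv' - Iv))
    have s2 := abs_add_le (-((Z' - Z) * Iuv') - Z * (Iuv' - Iuv)) ((Iu' - Iu) * Iv')
    have s3 := abs_sub (-((Z' - Z) * Iuv')) (Z * (Iuv' - Iuv))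
    rw [abs_neg] at s3
    nlinarith
  -- `|Cov'| ≤ (Z(1+a))² E / Kp`
  have hcov' : |Z' * Iuv' - Iu' * Iv'| ≤ (Z * (1 + a)) ^ 2 * E / Kp := by
    refine hb.trans ?_
    rw [div_le_div_iff_of_pos_right hKp]
    exact mul_le_mul_of_nonneg_right (pow_le_pow_left₀ hZ'0 hZ' 2) hE
  have s := abs_add_le ((Z * Iuv - Iu * Iv) - (Z' * Iuv' - Iu' * Iv')) (Z' * Iuv' - Iu' * Iv')
  rw [sub_add_cancel] at s
  linarith

/-- ★★ **S-POISSON BY APPROXIMATION.**  The quasi-local clustering bound `cov_decay_quasilocal` for a SMOOTH (not necessarily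
polynomial) potential `S` that is C²-approximable by polynomials (`C2PolyApprox S`), with the SAME constants: apply the
polynomial theorem to the approximant `p` (Hessian data `Λ + ε`, `h + ε`, profile `Θ + εM`, door `K − ε(1+M)`), compare the
tilted integrals (`|∫e^p F − ∫e^S F| ≤ (e^ε − 1)∫e^S|F|`) and let `ε → 0⁺`.  No Poisson equation is solved for `S`. [folklore] -/
theorem cov_decay_quasilocal_of_approx (hN : N ≠ 0) {S : Cfg ι N → ℝ} (hS : ContDiff ℝ ∞ S) (hA : C2PolyApprox S)
    {Λ : ℝ} (hHess : HessBound S Λ) {h : ι → ι → ℝ} (hOff : OffDiagHessBound S h) (hh0 : ∀ e e', 0 ≤ h e e')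
    (hsymm : ∀ e e', h e e' = h e' e) (D : ι → ℕ) {κ Θ : ℝ} (hκ : 0 ≤ κ)
    (hΘ : ∀ e, ∑ e', h e e' * (Real.exp (κ * |(D e : ℝ) - D e'|) - 1) ≤ Θ)
    (hK : 0 < (N : ℝ) / 2 - Λ - Θ)
    {u v : Cfg ι N → ℝ} (hu : ContDiff ℝ ∞ u) (hv : ContDiff ℝ ∞ v)
    {δu δv : ι → ℝ} (hδu : ∀ e, 0 ≤ δu e) (hδv : ∀ e, 0 ≤ δv e)
    (hLu : LinkLipschitz u δu) (hLv : LinkLipschitz v δv)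
    (hDv : ∀ e, δv e ≠ 0 → D e = 0) {m : ℕ} (hDu : ∀ e, δu e ≠ 0 → m ≤ D e) :
    |(∫ x : PSU ι N, Real.exp (S (emb x)) ∂(haarPi ι N)) *
          (∫ x : PSU ι N, Real.exp (S (emb x)) * (u (emb x) * v (emb x)) ∂(haarPi ι N)) -
        (∫ x : PSU ι N, Real.exp (S (emb x)) * u (emb x) ∂(haarPi ι N)) *
          (∫ x : PSU ι N, Real.exp (S (emb x)) * v (emb x) ∂(haarPi ι N))| ≤
      (∫ x : PSU ι N, Real.exp (S (emb x)) ∂(haarPi ι N)) ^ 2 *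
        (Real.exp (-κ * m) * (∑ e, δu e) * (∑ e, δv e)) / ((N : ℝ) / 2 - Λ - Θ) := by
  -- names for the real numbers involved
  have hSc : Continuous fun x : PSU ι N => S (emb x) := continuous_restrict hS
  have huc : Continuous fun x : PSU ι N => u (emb x) := continuous_restrict hu
  have hvc : Continuous fun x : PSU ι N => v (emb x) := continuous_restrict hv
  set K : ℝ := (N : ℝ) / 2 - Λ - Θ with hKdef
  set E : ℝ := Real.exp (-κ * m) * (∑ e, δu e) * (∑ e, δv e) with hEdef
  have hE0 : 0 ≤ E := by
    have := sum_nonneg fun e (_ : e ∈ univ) => hδu e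
    have := sum_nonneg fun e (_ : e ∈ univ) => hδv e
    positivity
  set M : ℝ := ∑ e, ∑ e', (Real.exp (κ * |(D e : ℝ) - D e'|) - 1) with hMdef
  have hterm0 : ∀ e e', 0 ≤ Real.exp (κ * |(D e : ℝ) - D e'|) - 1 := fun e e' => by
    linarith [Real.one_le_exp (by positivity : 0 ≤ κ * |(D e : ℝ) - D e'|)]
  have hM0 : 0 ≤ M := sum_nonneg fun e _ => sum_nonneg fun e' _ => hterm0 e e'
  have hrowM : ∀ e, ∑ e', (Real.exp (κ * |(D e : ℝ) - D e'|) - 1) ≤ M := fun e =>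
    single_le_sum (f := fun e => ∑ e', (Real.exp (κ * |(D e : ℝ) - D e'|) - 1))
      (fun e _ => sum_nonneg fun e' _ => hterm0 e e') (mem_univ e)
  set Z : ℝ := ∫ x : PSU ι N, Real.exp (S (emb x)) ∂(haarPi ι N) with hZdef
  set Iuv : ℝ := ∫ x : PSU ι N, Real.exp (S (emb x)) * (u (emb x) * v (emb x)) ∂(haarPi ι N) with hIuv
  set Iu : ℝ := ∫ x : PSU ι N, Real.exp (S (emb x)) * u (emb x) ∂(haarPi ι N) with hIu
  set Iv : ℝ := ∫ x : PSU ι N, Real.exp (S (emb x)) * v (emb x) ∂(haarPi ι N) with hIv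
  set Juv : ℝ := ∫ x : PSU ι N, Real.exp (S (emb x)) * |u (emb x) * v (emb x)| ∂(haarPi ι N) with hJuv
  set Ju : ℝ := ∫ x : PSU ι N, Real.exp (S (emb x)) * |u (emb x)| ∂(haarPi ι N) with hJu
  set Jv : ℝ := ∫ x : PSU ι N, Real.exp (S (emb x)) * |v (emb x)| ∂(haarPi ι N) with hJv
  have hZpos : 0 < Z := integral_exp_pos (integrable_of_continuous_PSU (Real.continuous_exp.comp hSc) _)
  have hJuv_le : |Iuv| ≤ Juv := abs_integral_exp_mul_le_integral_abs S _
  have hJu_le : |Iu| ≤ Ju := abs_integral_exp_mul_le_integral_abs S _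
  have hJv_le : |Iv| ≤ Jv := abs_integral_exp_mul_le_integral_abs S _
  set G : ℝ := Z * Juv + Ju * Jv with hGdef
  -- the squeeze function
  set Φ : ℝ → ℝ := fun ε => (Real.exp ε - 1) * (2 + (Real.exp ε - 1)) * G +
    (Z * (1 + (Real.exp ε - 1))) ^ 2 * E / (K - ε * (1 + M)) with hΦdef
  have hε₀ : 0 < K / (2 * (1 + M)) := div_pos hK (by positivity)
  -- KEY: for small ε, `|Cov_S| ≤ Φ ε`
  have key : ∀ ε, 0 < ε → ε < K / (2 * (1 + M)) → |Z * Iuv - Iu * Iv| ≤ Φ ε := by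
    intro ε hε hεK
    obtain ⟨dS, p, hpP, hsup, hHd, hOd⟩ := hA ε hε
    have hp : ContDiff ℝ ∞ p := contDiff_of_mem_polySpace hpP
    have hpS' : ContDiff ℝ ∞ (p - S) := hp.sub hS
    have hpS : S + (p - S) = p := add_sub_cancel S p
    have hHess_p : HessBound p (Λ + ε) := by
      have := hessBound_add hS hpS' hHess hHd
      rwa [hpS] at this
    have hOff_p : OffDiagHessBound p (h + (fun (_ : ι) (_ : ι) => ε)) := by
      have := offDiagHessBound_add hS hpS' hOff hOd
      rwa [hpS] at this
    have hh0' : ∀ e e', 0 ≤ (h + (fun (_ : ι) (_ : ι) => ε)) e e' := fun e e' => by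
      simp only [Pi.add_apply]; exact add_nonneg (hh0 e e') hε.le
    have hsymm' : ∀ e e', (h + (fun (_ : ι) (_ : ι) => ε)) e e' = (h + (fun (_ : ι) (_ : ι) => ε)) e' e :=
      fun e e' => by simp only [Pi.add_apply, hsymm e e']
    have hΘ' : ∀ e, ∑ e', (h + (fun (_ : ι) (_ : ι) => ε)) e e' * (Real.exp (κ * |(D e : ℝ) - D e'|) - 1) ≤ Θ + ε * M :=
      fun e => by
      simp only [Pi.add_apply, add_mul]
      rw [Finset.sum_add_distrib, ← mul_sum]
      exact add_le_add (hΘ e) (mul_le_mul_of_nonneg_left (hrowM e) hε.le)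
    have hεM : ε * (1 + M) < K / 2 := by
      have := (lt_div_iff₀ (by positivity : (0 : ℝ) < 2 * (1 + M))).1 hεK
      linarith
    have hKp : 0 < (N : ℝ) / 2 - (Λ + ε) - (Θ + ε * M) := by
      have : (N : ℝ) / 2 - (Λ + ε) - (Θ + ε * M) = K - ε * (1 + M) := by rw [hKdef]; ring
      rw [this]; linarith
    have hb := cov_decay_quasilocal hN hpP hHess_p hOff_p hh0' hsymm' D hκ hΘ' hKp hu hv hδu hδv hLu hLv hDv hDu
    have hKeq : (N : ℝ) / 2 - (Λ + ε) - (Θ + ε * M) = K - ε * (1 + M) := by rw [hKdef]; ring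
    rw [hKeq] at hb
    -- comparisons
    have hpc : Continuous fun x : PSU ι N => p (emb x) := continuous_restrict hp
    have hZ'pos : 0 < ∫ x : PSU ι N, Real.exp (p (emb x)) ∂(haarPi ι N) :=
      integral_exp_pos (integrable_of_continuous_PSU (Real.continuous_exp.comp hpc) _)
    have dZ : |(∫ x : PSU ι N, Real.exp (p (emb x)) ∂(haarPi ι N)) - Z| ≤ (Real.exp ε - 1) * Z := by
      have := abs_integral_exp_sub_le hS hp hsup (F := fun _ => (1 : ℝ)) continuous_const
      simp only [mul_one, abs_one] at this
      exact this
    have dIuv := abs_integral_exp_sub_le hS hp hsup (F := fun x => u (emb x) * v (emb x)) (huc.mul hvc)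
    have dIu := abs_integral_exp_sub_le hS hp hsup (F := fun x => u (emb x)) huc
    have dIv := abs_integral_exp_sub_le hS hp hsup (F := fun x => v (emb x)) hvc
    have ha : 0 ≤ Real.exp ε - 1 := by linarith [Real.one_le_exp hε.le]
    have hKp' : 0 < K - ε * (1 + M) := by linarith
    have := cov_squeeze_alg hZpos.le ha hE0 hKp' hJuv_le hJu_le hJv_le dZ dIuv dIu dIv hZ'pos.le hb
    simpa only [hΦdef] using this
  -- the limit `ε → 0⁺`
  have hΦ0 : Φ 0 = Z ^ 2 * E / K := by
    simp only [hΦdef, Real.exp_zero, sub_self, zero_mul, zero_add, add_zero, sub_zero, mul_one]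
  have hcont : ContinuousAt Φ 0 := by
    have h1 : ContinuousAt (fun ε : ℝ => Real.exp ε - 1) 0 :=
      (Real.continuous_exp.sub continuous_const).continuousAt
    have hden : ContinuousAt (fun ε : ℝ => K - ε * (1 + M)) 0 :=
      (continuous_const.sub (continuous_id.mul continuous_const)).continuousAt
    have hden0 : (fun ε : ℝ => K - ε * (1 + M)) 0 ≠ 0 := by simp; exact hK.ne'
    have h2 : ContinuousAt (fun ε : ℝ => (Real.exp ε - 1) * (2 + (Real.exp ε - 1)) * G) 0 :=
      (h1.mul (continuousAt_const.add h1)).mul continuousAt_const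
    have h3 : ContinuousAt (fun ε : ℝ => (Z * (1 + (Real.exp ε - 1))) ^ 2 * E) 0 :=
      ((continuousAt_const.mul (continuousAt_const.add h1)).pow 2).mul continuousAt_const
    exact h2.add (h3.div hden hden0)
  have hlim : Tendsto Φ (𝓝[>] (0 : ℝ)) (𝓝 (Φ 0)) := hcont.tendsto.mono_left nhdsWithin_le_nhds
  have hev : ∀ᶠ ε in 𝓝[>] (0 : ℝ), |Z * Iuv - Iu * Iv| ≤ Φ ε := by
    filter_upwards [Ioo_mem_nhdsGT hε₀] with ε hε using key ε hε.1 hε.2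
  have hfin : |Z * Iuv - Iu * Iv| ≤ Φ 0 := ge_of_tendsto hlim hev
  rw [hΦ0] at hfin
  exact hfin

/-- `C2PolyApprox` is stable under adding a polynomial (the Wilson term): `C2PolyApprox R → C2PolyApprox (q + R)` for
`q ∈ polySpace`. [folklore] -/
theorem c2PolyApprox_poly_add {q : Cfg ι N → ℝ} {dq : ℕ} (hq : q ∈ polySpace ι N dq) {R : Cfg ι N → ℝ}
    (hA : C2PolyApprox R) : C2PolyApprox (q + R) := by
  intro ε hε
  obtain ⟨dS, p, hpP, hsup, hH, hO⟩ := hA ε hε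
  have hfun : q + p - (q + R) = p - R := add_sub_add_left_eq_sub p R q
  refine ⟨max dq dS, q + p, Submodule.add_mem _ (polySpace_mono (le_max_left _ _) hq)
    (polySpace_mono (le_max_right _ _) hpP), fun x => ?_, ?_, ?_⟩
  · simp only [Pi.add_apply]
    rw [show q (emb x) + p (emb x) - (q (emb x) + R (emb x)) = p (emb x) - R (emb x) by ring]
    exact hsup x
  · rw [hfun]; exact hH
  · rw [hfun]; exact hO

end Approx

section ApproxDoor

variable {d N : ℕ} {L : ℕ} [NeZero L]

/-- ★★ **THE QUASI-LOCAL DOOR FOR SMOOTH (NON-POLYNOMIAL) REMAINDERS** — `beDoorQL_abs_le` with `R ∈ polySpace` replaced by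
`ContDiff ℝ ∞ R ∧ C2PolyApprox R` (e.g. `R` real-analytic: Bałaban's format), SAME door, SAME constant.  This is the receiver the
RG output actually needs, modulo only C²-Weierstrass (`C2PolyApprox`). [folklore] -/
theorem beDoorQL_abs_le_of_approx {Λ₀ : ℝ} (hH : WilsonHessianBound d N Λ₀) (hN : N ≠ 0) (β : ℝ) (hL : 1 < L)
    {R : Cfg (Edge d L) N → ℝ} (hRc : ContDiff ℝ ∞ R) (hRA : C2PolyApprox R)
    {ΛR : ℝ} (hRH : HessBound R ΛR) {hR : Edge d L → Edge d L → ℝ} (hRO : OffDiagHessBound R hR)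
    (hR0 : ∀ e e', 0 ≤ hR e e') (hRsymm : ∀ e e', hR e e' = hR e' e)
    (D : Edge d L → ℕ) (hD : ∀ e e', e' ∈ linkNbrT e → D e ≤ D e' + 1) {κ ΘR : ℝ} (hκ : 0 ≤ κ)
    (hΘR : ∀ e, ∑ e', hR e e' * (Real.exp (κ * |(D e : ℝ) - D e'|) - 1) ≤ ΘR)
    (hK : 0 < (N : ℝ) / 2 - ((N : ℝ) * |β| * Λ₀ + ΛR) -
      (max (6 * ((d : ℝ) - 1) * N * |β|) 0 * (Real.exp κ - 1) + ΘR))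
    {u v : Cfg (Edge d L) N → ℝ} (hu : ContDiff ℝ ∞ u) (hv : ContDiff ℝ ∞ v)
    {δu δv : Edge d L → ℝ} (hδu : ∀ e, 0 ≤ δu e) (hδv : ∀ e, 0 ≤ δv e)
    (hLu : LinkLipschitz u δu) (hLv : LinkLipschitz v δv)
    (hDv : ∀ e, δv e ≠ 0 → D e = 0) {m : ℕ} (hDu : ∀ e, δu e ≠ 0 → m ≤ D e) :
    |(∫ x : PSU (Edge d L) N, Real.exp ((wilsonPot d N L β + R) (emb x)) ∂(haarPi (Edge d L) N)) *
          (∫ x : PSU (Edge d L) N, Real.exp ((wilsonPot d N L β + R) (emb x)) * (u (emb x) * v (emb x))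
            ∂(haarPi (Edge d L) N)) -
        (∫ x : PSU (Edge d L) N, Real.exp ((wilsonPot d N L β + R) (emb x)) * u (emb x) ∂(haarPi (Edge d L) N)) *
          (∫ x : PSU (Edge d L) N, Real.exp ((wilsonPot d N L β + R) (emb x)) * v (emb x) ∂(haarPi (Edge d L) N))|
      ≤ (∫ x : PSU (Edge d L) N, Real.exp ((wilsonPot d N L β + R) (emb x)) ∂(haarPi (Edge d L) N)) ^ 2 *
          (Real.exp (-κ * m) * (∑ e, δu e) * (∑ e, δv e)) /
        ((N : ℝ) / 2 - ((N : ℝ) * |β| * Λ₀ + ΛR) - (max (6 * ((d : ℝ) - 1) * N * |β|) 0 * (Real.exp κ - 1) + ΘR)) := by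
  have hS : ContDiff ℝ ∞ (wilsonPot d N L β + R) := (contDiff_wilsonPot β).add hRc
  have hA : C2PolyApprox (wilsonPot d N L β + R) :=
    c2PolyApprox_poly_add (wilsonPot_mem_polySpace (d := d) (N := N) (L := L) β) hRA
  have hHess : HessBound (wilsonPot d N L β + R) ((N : ℝ) * |β| * Λ₀ + ΛR) :=
    hessBound_add (contDiff_wilsonPot β) hRc (hessBound_wilsonPot hH β) hRH
  have hOff : OffDiagHessBound (wilsonPot d N L β + R) (wilsonH d N L β + hR) :=
    offDiagHessBound_add (contDiff_wilsonPot β) hRc (offDiagHessBound_wilsonPot hL β) hRO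
  have hh0 : ∀ e e', 0 ≤ (wilsonH d N L β + hR) e e' := fun e e' => by
    simp only [Pi.add_apply]; exact add_nonneg (wilsonH_nonneg N β e e') (hR0 e e')
  have hsymm : ∀ e e', (wilsonH d N L β + hR) e e' = (wilsonH d N L β + hR) e' e := fun e e' => by
    simp only [Pi.add_apply]; rw [wilsonH_symm N β e e', hRsymm e e']
  have hκ1 : 0 ≤ Real.exp κ - 1 := by linarith [Real.one_le_exp hκ]
  have hWpt : ∀ e e', wilsonH d N L β e e' * (Real.exp (κ * |(D e : ℝ) - D e'|) - 1) ≤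
      wilsonH d N L β e e' * (Real.exp κ - 1) := fun e e' => by
    by_cases hw : wilsonH d N L β e e' = 0
    · rw [hw, zero_mul, zero_mul]
    refine mul_le_mul_of_nonneg_left ?_ (wilsonH_nonneg N β e e')
    have h1 : D e ≤ D e' + 1 := hD e e' (mem_linkNbrT_of_wilsonH_ne_zero N hw)
    have h2 : D e' ≤ D e + 1 := hD e' e (mem_linkNbrT_of_wilsonH_ne_zero N (by rwa [wilsonH_symm N β e' e]))
    have h3 : |(D e : ℝ) - D e'| ≤ 1 := by
      rw [abs_le]; constructor
      · have : (D e' : ℝ) ≤ D e + 1 := by exact_mod_cast h2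
        linarith
      · have : (D e : ℝ) ≤ D e' + 1 := by exact_mod_cast h1
        linarith
    have h4 : κ * |(D e : ℝ) - D e'| ≤ κ := by nlinarith [abs_nonneg ((D e : ℝ) - D e')]
    linarith [Real.exp_le_exp.2 h4]
  have hΘ : ∀ e, ∑ e', (wilsonH d N L β + hR) e e' * (Real.exp (κ * |(D e : ℝ) - D e'|) - 1) ≤
      max (6 * ((d : ℝ) - 1) * N * |β|) 0 * (Real.exp κ - 1) + ΘR := fun e => by
    simp only [Pi.add_apply, add_mul]
    rw [Finset.sum_add_distrib]
    refine add_le_add ?_ (hΘR e)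
    calc ∑ e', wilsonH d N L β e e' * (Real.exp (κ * |(D e : ℝ) - D e'|) - 1)
        ≤ ∑ e', wilsonH d N L β e e' * (Real.exp κ - 1) := sum_le_sum fun e' _ => hWpt e e'
      _ = (∑ e', wilsonH d N L β e e') * (Real.exp κ - 1) := by rw [sum_mul]
      _ ≤ max (6 * ((d : ℝ) - 1) * N * |β|) 0 * (Real.exp κ - 1) :=
          mul_le_mul_of_nonneg_right ((sum_wilsonH_le N β e).trans (le_max_left _ _)) hκ1
  have hK' : 0 < (N : ℝ) / 2 - ((N : ℝ) * |β| * Λ₀ + ΛR) -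
      (max (6 * ((d : ℝ) - 1) * N * |β|) 0 * (Real.exp κ - 1) + ΘR) := hK
  exact cov_decay_quasilocal_of_approx hN hS hA hHess hOff hh0 hsymm D hκ hΘ hK' hu hv hδu hδv hLu hLv hDv hDu

/-- ★★ Normalised form: `|Cov_{Z⁻¹e^{Wilson β + R}}(u,v)| ≤ e^{−κ m}(Σδu)(Σδv)/K` for SMOOTH C²-approximable `R` in the door.
[folklore] -/
theorem beDoorQL_gibbsCov_le_of_approx {Λ₀ : ℝ} (hH : WilsonHessianBound d N Λ₀) (hN : N ≠ 0) (β : ℝ) (hL : 1 < L)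
    {R : Cfg (Edge d L) N → ℝ} (hRc : ContDiff ℝ ∞ R) (hRA : C2PolyApprox R)
    {ΛR : ℝ} (hRH : HessBound R ΛR) {hR : Edge d L → Edge d L → ℝ} (hRO : OffDiagHessBound R hR)
    (hR0 : ∀ e e', 0 ≤ hR e e') (hRsymm : ∀ e e', hR e e' = hR e' e)
    (D : Edge d L → ℕ) (hD : ∀ e e', e' ∈ linkNbrT e → D e ≤ D e' + 1) {κ ΘR : ℝ} (hκ : 0 ≤ κ)
    (hΘR : ∀ e, ∑ e', hR e e' * (Real.exp (κ * |(D e : ℝ) - D e'|) - 1) ≤ ΘR)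
    (hK : 0 < (N : ℝ) / 2 - ((N : ℝ) * |β| * Λ₀ + ΛR) -
      (max (6 * ((d : ℝ) - 1) * N * |β|) 0 * (Real.exp κ - 1) + ΘR))
    {u v : Cfg (Edge d L) N → ℝ} (hu : ContDiff ℝ ∞ u) (hv : ContDiff ℝ ∞ v)
    {δu δv : Edge d L → ℝ} (hδu : ∀ e, 0 ≤ δu e) (hδv : ∀ e, 0 ≤ δv e)
    (hLu : LinkLipschitz u δu) (hLv : LinkLipschitz v δv)
    (hDv : ∀ e, δv e ≠ 0 → D e = 0) {m : ℕ} (hDu : ∀ e, δu e ≠ 0 → m ≤ D e) :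
    |gibbsCov (wilsonPot d N L β + R) u v| ≤
      Real.exp (-κ * m) * (∑ e, δu e) * (∑ e, δv e) /
        ((N : ℝ) / 2 - ((N : ℝ) * |β| * Λ₀ + ΛR) - (max (6 * ((d : ℝ) - 1) * N * |β|) 0 * (Real.exp κ - 1) + ΘR)) := by
  have hmain := beDoorQL_abs_le_of_approx hH hN β hL hRc hRA hRH hRO hR0 hRsymm D hD hκ hΘR hK hu hv hδu hδv hLu hLv
    hDv hDu
  set S := wilsonPot d N L β + R with hS
  have hSc : Continuous fun U : PSU (Edge d L) N => S (emb U) :=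
    continuous_restrict ((contDiff_wilsonPot β).add hRc)
  set Z : ℝ := ∫ U, Real.exp (S (emb U)) ∂(haarPi (Edge d L) N) with hZ
  have hZpos : 0 < Z := integral_exp_pos (integrable_of_continuous_PSU (Real.continuous_exp.comp hSc) _)
  rw [gibbsCov, gibbsCov_eq_div hZpos.ne', abs_div, abs_of_pos (pow_pos hZpos 2), div_le_iff₀ (pow_pos hZpos 2)]
  refine hmain.trans (le_of_eq ?_)
  ring

end ApproxDoor

end Summit.Ventures.YMGap.BEDoor
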